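import Literature.MathematicalPhysics.QuantumFieldTheory.Balaban1983to89.B1RG242Torus
import Literature.MathematicalPhysics.QuantumFieldTheory.Balaban1983to89.B5Ineq137

/-!
# `Balaban1983to89.B5Display136Torus` — the kernel identity (1.136) of [B5] for Bałaban's scalar torus tower,
PROVED from the renormalization group equation (2.43) of [B1] (tree `B1RG242Torus.display243`)

Sources under audit (cell pub-balaban): T. Bałaban, *(Higgs)₂,₃ quantum fields in a finite volume. I*, Commun.
Math. Phys. **85** (1982) 603–636 [`Balaban1982Higgs1`, "B1"], p. 607 [PDF 5] (1.21)–(1.23) (render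
`b2b-balaban-ref1/pages/1982-cmp85-higgs23-I/1982-cmp85-higgs23-I-p005-x2.png`, read as image); T. Bałaban,
*Propagators and renormalization transformations for lattice gauge theories. I*, Commun. Math. Phys. **95** (1984)
17–40 [`Balaban1984PropagatorsI`, "B5"], pp. 39–40 [PDF 23–24] (1.135)–(1.136) (quoted verbatim in the tree module
`B5Ineq137`, docstrings of `ScaleData`, `kerW`, `Display136`); T. Bałaban, *Regularity and decay of lattice Green's
functions*, Commun. Math. Phys. **89** (1983) 571–597 [`Balaban1983RegularityDecay`, "B4"], p. 582 (2.34), (2.38).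

## WHAT IS PRINTED (verbatim, B1 p. 607; the B5 displays are quoted in `B5Ineq137`)

«For the subsets Λ of the lattice ηZ^d a measure is defined by the formula |Λ| = Σ_{x∈Λ} η^d = η^d (a number of
points in Λ). (1.21) For the functions defined on the points of the lattice ηZ^d or on the bonds of this lattice, a
scalar product is defined as usual by the formula (1.5) with η instead of ε.» … «We use only the canonical rescalings,
so we have φ(x) = (η/δ)^{−(d−2)/2} φ′((δ/η)x), x∈ηZ^d, or φ((η/δ)x) = (η/δ)^{−(d−2)/2} φ′(x), x∈δZ^d, (1.22) and the
same formulas for vector fields. They imply the formulas for the rescalings of the functions of fields, e.g. we have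
for a derivative (∂^η_μφ)(x) = (η/δ)^{−d/2}(∂^δ_μφ′)((δ/η)x) for x∈ηZ^d. (1.23)» … «If we rescale (1.11) from the
ε-lattice to an sε-lattice, then from (1.22), (1.23) it follows that we get the action again of the form (1.11), but
with ε replaced by sε, T_ε by T_{sε}, the constants m₀², μ₀² are replaced by m₀²s⁻², μ₀²s⁻², …».
B1 p. 611 [PDF 9] (render `…-p009-x2.png`, read as image; also quoted in the tree module `B1RG242`): «C^{(k),L^kε}(Ω, A)
= (a(L^{k+1}ε)^{−2}P(A) + Δ^{(k),L^kε}(Ω, A))^{−1}. (2.30) In the sequel we will use the covariance rescaled to the unit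
lattice and it is of the form C^{(k)}(Ω, A) = (aL^{−2}P(A) + Δ^{(k)}(Ω, A))^{−1}. (2.31) It is not clear from the
formulas (2.30), (2.31) that the covariances are well defined. It is so, and it is one of the assertions of
Proposition 2.3.»

B5 (1.136) (pp. 39–40, quoted in `B5Ineq137.Display136`) writes the kernel of ∂_μG′_k∂*_ν as the sum over j of the
kernels of the terms of (1.135) = [B4] (2.34) «with □ replaced by the whole torus», EACH TERM RESCALED TO ITS UNIT
LATTICE: `K0` = C^{(0)}(η^{−1}x, η^{−1}x′), `K1` = (∂^{L^{−j}}_μG′_jQ′*_j)((L^jη)^{−1}x, y), `K2` = C^{(j)}(y, y′),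
`K3` = (Q′_jG′_j∂^{L^{−j}*}_ν)(y′, (L^jη)^{−1}x′) with the explicit weight L^{−jd} on the x′-sum (the typed carrier
`B5Ineq137.ScaleData`, fields `E`, `K0`–`K3`, `a`, and the typed identity `B5Ineq137.Display136`).

## WHAT THIS FILE CERTIFIES (kernel-checked)

For Bałaban's CONCRETE scalar tower on the tori with U = 1 — `B1RG242Torus.tower P a msq`: levels T^{(j)} = `Site P j`,
H = −Δ^ε + m², Q_j, Q^*_j, α_j = a_j(L^jε)^{−2} (B5's η is the tower's ε = `P.eps`, B5's k ≤ the tower's K) — and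
ANY `S : B5.Setting` with `1 ≤ S.k`, the `ScaleData S` instance `scaleData P S A a msq` whose
* operator is `E μ ν f x := ((∂^ε_μ · G^ε_{S.k} · (∂^ε_ν)ᵀ) f)(x)` (∂* = transpose for the scalar products (1.5)/(1.21)
  with the same weight on sites and bonds — reading (vii) of `B1RG242Torus`, DIVERGENCE D-pv07.13),
* kernels are the MATRIX ENTRIES of the tower's operators RESCALED TO THE UNIT LATTICE OF THEIR LEVEL by explicit
  powers of s_j = L^jε = `P.spacing j` (THE DICTIONARY, below): `K0 μ ν x x′ := (∂^ε_μ G^ε_1 ∂^{εᵀ}_ν)(x,x′)`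
  (G^ε_1 = C^{(0),ε}, `B1RG242Torus.G_one`), `K1 j μ x ⟨j,y⟩ := s_j^{−1}(∂^ε_μ G^ε_j Q^*_j)(x,y)`,
  `K2 j ⟨j,y⟩ ⟨j,y′⟩ := s_j^{−2} C^{(j),L^jε}(y,y′)`, `K3 j ν ⟨j,y′⟩ x′ := s_j^{−1}L^{jd}(Q_j G^ε_j ∂^{εᵀ}_ν)(y′,x′)`, zero
  off level j (the unit lattices of all levels are carried by the disjoint union `(j : ℕ) × Site P j`, `TU j` = level j),
* `a j := B1.aSeq a L j` (a_j of (2.13)/(1.135)), `eval f x := f x`, `TX := univ`, `Dir := Fin d`,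
* remaining fields (`holderF`, `supF`, `comp`, `cube`, `distX`, `dXU`, `dUU`) supplied by the caller (`Aux`) — (1.136)
  does not constrain them,
SATISFIES `B5Ineq137.Display136 (scaleData P S A a msq) L d` for every `0 < a`, `0 ≤ m²`, `1 ≤ S.k`
(`display136_of_tower`).  That is: the HYPOTHESIS (1.136) of `B5Ineq137.ineq137_of_display136` is a THEOREM for the
concrete scalar torus tower.  Proof = (2.43) along the tower (`B1RG242Torus.display243`, itself kernel-proved from
(2.42)) ⇒ ∂_μG_k∂ᵀ_ν = Σ_{j=1}^{k−1} ∂_μ(term_j)∂ᵀ_ν + ∂_μG_1∂ᵀ_ν; the columns of ∂^ε_ν sum to zero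
(`deriv_transpose_mulVec_const`: every site has exactly one predecessor x − e_ν on the torus), so the operator acts
through differences f(x′) − f(x) (`mulVec_eq_sum_mul_sub`) — the first line of (1.136); the (x,x′) entry of
∂_μ(α_j²G_jQ^*_jC^{(j)}Q_jG_j)∂ᵀ_ν is α_j² Σ_{y,y′}(∂_μG_jQ^*_j)(x,y)C^{(j)}(y,y′)(Q_jG_j∂ᵀ_ν)(y′,x′) (`triple_apply`), and
the powers of s_j in the dictionary recombine to α_j² = a_j²s_j^{−4} against the weight L^{−jd} (`term_entry`).

## THE DICTIONARY (a TYPED READING of (1.21)–(1.23), cell DIVERGENCE D-pv07.15; kernel evidence §2)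

Matrices of the tower act on functions by plain sums, `(M f)(x) = Σ_{x′} M(x,x′) f(x′)`, i.e. a matrix entry is a
kernel with respect to the COUNTING measure; the printed kernel with respect to the measure (1.21) of a lattice of
spacing t is entry·t^{−d}.  Rescaling from spacing t to spacing t/s relabels no site (the tori `Site P j` are
spacing-free) and acts on the tower's primitives by: ∂^{t/s}_μ = s·∂^t_μ (`deriv_rescale`, the operator content of
(1.23)); −Δ^{t/s} + s²m² = s²(−Δ^t + m²) (`hOp_rescale`, «m₀² … replaced by m₀²s⁻²» read from the sε-lattice);
Q_j, Q^*_j unchanged (`B1RG242Torus.Qk_mulVec`/`Qks_mulVec` carry no spacing); hence every inverse of a second-order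
operator scales as s²: G^ε_j = s_j²·G_j^{resc} with G_j^{resc} = (−Δ^{L^{−j}} + m_j² + a_jQ^*_jQ_j)^{−1}, m_j² = s_j²m², the
[B4] (2.44) operator (`Grs`, `G_eq_smul_Grs` — PROVED), and likewise C^{(j),L^jε} = s_j²·C^{(j)} with C^{(j)} =
(aL^{−2}P + Δ^{(j)})^{−1} the [B1] (2.31) «covariance rescaled to the unit lattice» (`Crs`, `C_eq_smul_Crs` — PROVED, §6).  Consequently `K1 j μ x ⟨j,y⟩ = (∂^{L^{−j}}_μ G_j^{resc} Q^*_j)(x,y)` (`K1_eq`: the plain entry = the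
printed kernel, the y-sum over the unit lattice T₁^{(j)} having weight 1), `K3 j ν ⟨j,y′⟩ x′ = L^{jd}·(Q_j G_j^{resc}
∂^{L^{−j}ᵀ}_ν)(y′,x′)` (`K3_eq`: entry·(L^{−j})^{−d} = the kernel for the weight L^{−jd} that (1.136) writes explicitly),
`K0 μ ν x x′ = (∂^1_μ G_0^{unit} ∂^{1ᵀ}_ν)(x,x′)` with G_0^{unit} = (−Δ^1 + ε²m² + aL^{−2}Q^*_1Q_1)^{−1} = C^{(0)} rescaled by η = ε
(`K0_eq`), and `K2 j ⟨j,y⟩ ⟨j,y′⟩ = C^{(j)}(y,y′)` (`K2_eq`, §6: the plain entry of the (2.31) operator).  The constant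
(η/δ)^{−(d−2)/2} of (1.22) multiplies fields, not operators, and cancels from every conjugated kernel.

## SCOPE / NOT CERTIFIED

* The ESTIMATES (2.35)–(2.37) for these kernels (`B5Ineq137.Leaf235to237`, uniformity in j, k) are NOT touched: they
  stay hypotheses of `ineq137_of_display136`; whether B4 Lemma 2.4's normalisation is exactly that of `K1`–`K3` is what
  the dictionary lemmas `K1_eq`, `K3_eq`, `K0_eq` expose for a cross-reader (GAPS G-pv07-5 R3: the torus version of
  Lemma 2.4 is a located leaf).
* U ≠ 1 (gauge fields), the Ω/Neumann versions G(□), C^{(k)}_Λ (2.32), and the levels j > m + K of the tower's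
  completion (D-pv07.13: identity relabellings, not Bałaban's) are out of scope; `S.k` is not tied to `P.K` here ((1.135) is used in B5 at
  the unit lattice k: take `S.k = P.K`, `Params.spacing_K`).
* Nothing here is summit progress: an algebraic identity between kernel-proved finite matrices.
-/

namespace Literature.MathematicalPhysics.QuantumFieldTheory.Balaban1983to89

open Matrix

noncomputable section

namespace B5Display136Torus

open B1RG242Torus

/-! ## §1 Lattice facts: the columns of ∂ sum to zero; an operator killing constants acts through differences -/

section Lattice

variable {P : Params} {i : ℕ}

/-- (x − e_μ) + e_μ = x on the torus T^{(i)}. [folklore] -/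
theorem shift_unshift (x : Site P i) (μ : Fin P.d) : Site.shift (Site.unshift x μ) μ = x := by
  funext ν
  by_cases h : ν = μ
  · subst h
    simp only [Site.shift, Site.unshift, Function.update_self, sub_add_cancel]
  · simp only [Site.shift, Site.unshift, Function.update_of_ne h]

/-- (x + e_μ) − e_μ = x on the torus T^{(i)}. [folklore] -/
theorem unshift_shift (x : Site P i) (μ : Fin P.d) : Site.unshift (Site.shift x μ) μ = x := by
  funext ν
  by_cases h : ν = μ
  · subst h
    simp only [Site.shift, Site.unshift, Function.update_self, add_sub_cancel_right]
  · simp only [Site.shift, Site.unshift, Function.update_of_ne h]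

/-- x = x′ + e_μ iff x′ = x − e_μ: every site has exactly one predecessor in each direction. [folklore] -/
theorem eq_shift_iff (x x' : Site P i) (μ : Fin P.d) : x = Site.shift x' μ ↔ x' = Site.unshift x μ := by
  constructor
  · rintro rfl
    rw [unshift_shift]
  · rintro rfl
    rw [shift_unshift]

/-- The columns of the shift matrix sum to one: (Sᵀ_μ c)(x) = c. [folklore] -/
theorem shiftMat_transpose_mulVec_const (μ : Fin P.d) (c : ℝ) :
    (shiftMat P i μ)ᵀ *ᵥ (fun _ => c) = fun _ => c := by
  funext x
  simp only [Matrix.mulVec, dotProduct, Matrix.transpose_apply, shiftMat, ite_mul, one_mul, zero_mul]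
  simp_rw [eq_shift_iff x _ μ]
  rw [Finset.sum_ite_eq', if_pos (Finset.mem_univ _)]

/-- The columns of ∂^s_μ sum to zero: (∂^s_μ)ᵀ applied to a constant function vanishes (B1 (1.4) on a torus).
[folklore] -/
theorem deriv_transpose_mulVec_const (s : ℝ) (μ : Fin P.d) (c : ℝ) :
    (deriv P i s μ)ᵀ *ᵥ (fun _ => c) = 0 := by
  rw [B1RG242Torus.deriv, Matrix.transpose_smul, Matrix.transpose_sub, Matrix.transpose_one,
    Matrix.smul_mulVec, Matrix.sub_mulVec, Matrix.one_mulVec, shiftMat_transpose_mulVec_const, sub_self,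
    smul_zero]

/-- Any operator of the form A∂^{sᵀ}_μ kills the constants. [folklore] -/
theorem mul_deriv_transpose_mulVec_const {ι : Type} [Fintype ι] (A : Matrix ι (Site P i) ℝ) (s : ℝ) (μ : Fin P.d)
    (c : ℝ) : (A * (deriv P i s μ)ᵀ) *ᵥ (fun _ => c) = 0 := by
  rw [← Matrix.mulVec_mulVec, deriv_transpose_mulVec_const, Matrix.mulVec_zero]

/-- An operator whose rows sum to zero acts through differences: (Mf)(x) = Σ_{x′} M(x,x′)(f(x′) − f(x)) — the first
line of (1.136). [folklore] -/
theorem mulVec_eq_sum_mul_sub {ι : Type} [Fintype ι] (M : Matrix ι ι ℝ) (hM : M *ᵥ (fun _ => (1 : ℝ)) = 0)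
    (f : ι → ℝ) (x : ι) : (M *ᵥ f) x = ∑ x', M x x' * (f x' - f x) := by
  have h0 : ∑ x', M x x' = 0 := by
    have h := congr_fun hM x
    simpa [Matrix.mulVec, dotProduct] using h
  simp only [Matrix.mulVec, dotProduct, mul_sub, Finset.sum_sub_distrib, ← Finset.sum_mul, h0, zero_mul, sub_zero]

/-- The (x,x′) entry of a product P·C·R through the middle indices: Σ_{y,y′} P(x,y)C(y,y′)R(y′,x′). [folklore] -/
theorem triple_apply {ι κ : Type} [Fintype κ] (Pm : Matrix ι κ ℝ) (C : Matrix κ κ ℝ) (R : Matrix κ ι ℝ)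
    (x x' : ι) : (Pm * C * R) x x' = ∑ y, ∑ y', Pm x y * C y y' * R y' x' := by
  rw [Matrix.mul_apply]
  simp_rw [Matrix.mul_apply, Finset.sum_mul]
  rw [Finset.sum_comm]

end Lattice

/-! ## §2 Rescaling (the operator content of B1 (1.22)–(1.23)): kernel evidence for the dictionary -/

section Rescaling

variable (P : Params) {i : ℕ}

/-- ∂^{t/s}_μ = s·∂^t_μ as matrices on the same torus: the lattice derivative scales as (length)^{−1} under the
rescaling x = s·x̃ — the operator content of (1.23) (the field normalisation (η/δ)^{−(d−2)/2} of (1.22) cancels).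
[cite: Balaban1982Higgs1, (1.23) p.607] -/
theorem deriv_rescale (t s : ℝ) (μ : Fin P.d) : deriv P i (t / s) μ = s • deriv P i t μ := by
  rw [B1RG242Torus.deriv, B1RG242Torus.deriv, smul_smul, inv_div, div_eq_mul_inv]

/-- −Δ^{t/s} + s²m² = s²(−Δ^t + m²): the Laplacian scales as (length)^{−2} and the mass as printed («the constants
m₀², μ₀² are replaced by m₀²s⁻², μ₀²s⁻²», read from the coarser lattice). [cite: Balaban1982Higgs1, (1.23) p.607] -/
theorem hOp_rescale (t s msq : ℝ) : hOp P i (t / s) (s ^ 2 * msq) = s ^ 2 • hOp P i t msq := by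
  rw [hOp, hOp, smul_add, Finset.smul_sum, smul_smul]
  congr 1
  refine Finset.sum_congr rfl fun μ _ => ?_
  rw [deriv_rescale, Matrix.transpose_smul, Matrix.smul_mul, Matrix.mul_smul, smul_smul, pow_two]

/-- The level-j operator RESCALED TO THE L^{−j}-LATTICE: G_j^{resc} = (−Δ^{ξ} + m_j² + a_jQ^*_jQ_j)^{−1}, ξ = ε/(L^jε) = L^{−j},
m_j² = (L^jε)²m² — the operator of the basic equation [B4] (2.44) «(−Δ^ξ + m_j² + a_jQ_j^*Q_j)φ₀ = f» on the whole
torus. [cite: Balaban1983RegularityDecay, (2.44) p.584] -/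
def Grs (a msq : ℝ) (j : ℕ) : Matrix (Site P 0) (Site P 0) ℝ :=
  (hOp P 0 (P.eps / P.spacing j) (P.spacing j ^ 2 * msq) + B1.aSeq a P.L j • (Qks P j * Qk P j))⁻¹

/-- G_0^{unit} = (−Δ^1 + ε²m² + aL^{−2}Q^*_1Q_1)^{−1}: the operator C^{(0),ε} = G^ε_1 ((2.17)/(2.30), `B1RG242Torus.G_one`)
rescaled by η = ε to the unit lattice ε^{−1}T_ε — the «C^{(0)}(η^{−1}x, η^{−1}x′)» of (1.136).
[cite: Balaban1984PropagatorsI, (1.136) p.40] -/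
def G0unit (a msq : ℝ) : Matrix (Site P 0) (Site P 0) ℝ :=
  (hOp P 0 1 (P.eps ^ 2 * msq) + (a * ((P.L : ℝ) ^ 2)⁻¹) • (Qks P 1 * Qk P 1))⁻¹

variable {P}

/-- Inverses of second-order operators scale as (length)²: (−Δ^t + m² + c·Q^*Q)^{−1} = s²·(−Δ^{t/s} + s²m² + s²c·Q^*Q)^{−1}
whenever the former is a genuine inverse. [folklore] -/
theorem inv_rescale {t s msq c : ℝ} (hs : s ≠ 0) (QQ : Matrix (Site P i) (Site P i) ℝ)
    (hA : IsUnit (hOp P i t msq + c • QQ)) :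
    (hOp P i t msq + c • QQ)⁻¹ = s ^ 2 • (hOp P i (t / s) (s ^ 2 * msq) + (s ^ 2 * c) • QQ)⁻¹ := by
  have hs2 : s ^ 2 ≠ 0 := pow_ne_zero 2 hs
  have hdet : IsUnit (hOp P i t msq + c • QQ).det := (Matrix.isUnit_iff_isUnit_det _).mp hA
  have e : hOp P i (t / s) (s ^ 2 * msq) + (s ^ 2 * c) • QQ = s ^ 2 • (hOp P i t msq + c • QQ) := by
    rw [hOp_rescale, smul_add, smul_smul]
  have key : (s ^ 2 • (hOp P i t msq + c • QQ))⁻¹ = (s ^ 2)⁻¹ • (hOp P i t msq + c • QQ)⁻¹ :=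
    Matrix.inv_eq_left_inv (by
      rw [Matrix.smul_mul, Matrix.mul_smul, smul_smul, inv_mul_cancel₀ hs2, one_smul,
        Matrix.nonsing_inv_mul _ hdet])
  rw [e, key, smul_smul, mul_inv_cancel₀ hs2, one_smul]

/-- **G^ε_j = (L^jε)²·G_j^{resc}** for Bałaban's levels 1 ≤ j: the tower's G^ε_j = (−Δ^ε + m² + a_j(L^jε)^{−2}Q^*_jQ_j)^{−1}
((2.20)) is (L^jε)² times the [B4] (2.44) operator on the L^{−j}-lattice — PROVED (the dictionary's rule "inverses of
second-order operators scale as (length)²"). [cite: Balaban1982Higgs1, (2.20) p.610, (1.23) p.607] -/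
theorem G_eq_smul_Grs {a msq : ℝ} (ha : 0 < a) (hm : 0 ≤ msq) {j : ℕ} (hj : 1 ≤ j) :
    (tower P a msq).G j = P.spacing j ^ 2 • Grs P a msq j := by
  have hs : P.spacing j ≠ 0 := (P.spacing_pos j).ne'
  have hA : IsUnit (H P msq + α P a j • (Qks P j * Qk P j)) := (consistent P ha hm).G_arg j hj
  show (H P msq + α P a j • (Qks P j * Qk P j))⁻¹ = _
  rw [H, α, inv_rescale hs _ (by simpa only [H, α] using hA), Grs,
    show P.spacing j ^ 2 * (B1.aSeq a P.L j * (P.spacing j ^ 2)⁻¹) = B1.aSeq a P.L j by field_simp]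

/-- **G^ε_1 = C^{(0),ε} = ε²·G_0^{unit}**: the j = 0 term rescaled by η = ε to the unit lattice (a_1 = a, (Lε)^{−2}ε² = L^{−2}).
[cite: Balaban1982Higgs1, (2.30) p.611, (1.23) p.607] -/
theorem G_one_eq_smul_G0unit {a msq : ℝ} (ha : 0 < a) (hm : 0 ≤ msq) :
    (tower P a msq).G 1 = P.eps ^ 2 • G0unit P a msq := by
  have hε : P.eps ≠ 0 := P.eps_pos.ne'
  have hL : (P.L : ℝ) ≠ 0 := P.cast_L_pos.ne'
  have hA : IsUnit (H P msq + α P a 1 • (Qks P 1 * Qk P 1)) := (consistent P ha hm).G_arg 1 le_rfl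
  show (H P msq + α P a 1 • (Qks P 1 * Qk P 1))⁻¹ = _
  rw [H, α, inv_rescale hε _ (by simpa only [H, α] using hA), G0unit, div_self hε,
    B1.aSeq_one (one_lt_cast_L P),
    show P.eps ^ 2 * (a * (P.spacing 1 ^ 2)⁻¹) = a * ((P.L : ℝ) ^ 2)⁻¹ by
      rw [Params.spacing, pow_one]; field_simp]

end Rescaling

/-! ## §3 The `ScaleData` instance of the concrete tower -/

section Instance

variable (P : Params) (S : B5.Setting)

/-- The fields of `B5Ineq137.ScaleData` that the identity (1.136) does not constrain (norms (1.108)–(1.109), components,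
cubes Δ̃(y), distances), supplied by the user of the instance. [folklore] -/
structure Aux where
  holderF : ℝ → (Site P 0 → ℝ) → ℝ
  supF : (Site P 0 → ℝ) → ℝ
  comp : S.Loc → Fin P.d → (Site P 0 → ℝ)
  cube : Site P 0 → S.Site → Prop
  distX : Site P 0 → Site P 0 → ℝ
  dXU : ℕ → Site P 0 → ((j : ℕ) × Site P j) → ℝ
  dUU : ℕ → ((j : ℕ) × Site P j) → ((j : ℕ) × Site P j) → ℝ

variable {P}

/-- A level-j quantity read at a point of the disjoint union of all unit lattices T₁^{(i)}, i ∈ ℕ: its value on level j,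
zero elsewhere. [folklore] -/
def atLevel (j : ℕ) (g : Site P j → ℝ) (u : (i : ℕ) × Site P i) : ℝ :=
  if h : u.1 = j then g (h ▸ u.2) else 0

/-- `atLevel` on a level-j point is the value. [folklore] -/
@[simp] theorem atLevel_mk (j : ℕ) (g : Site P j → ℝ) (y : Site P j) : atLevel j g ⟨j, y⟩ = g y := by
  unfold atLevel
  rw [dif_pos rfl]

/-- `atLevel` vanishes off level j. [folklore] -/
theorem atLevel_of_ne (j : ℕ) (g : Site P j → ℝ) (u : (i : ℕ) × Site P i) (h : u.1 ≠ j) : atLevel j g u = 0 := by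
  unfold atLevel
  rw [dif_neg h]

variable (P)

/-- The level-j unit lattice T₁^{(j)} inside the disjoint union. [folklore] -/
def TU (j : ℕ) : Finset ((i : ℕ) × Site P i) := Finset.univ.map (Function.Embedding.sigmaMk j)

/-- Sums over `TU j` are sums over `Site P j`. [folklore] -/
theorem sum_TU (j : ℕ) (F : ((i : ℕ) × Site P i) → ℝ) : ∑ u ∈ TU P j, F u = ∑ y : Site P j, F ⟨j, y⟩ := by
  rw [TU, Finset.sum_map]
  rfl

/-- `E μ ν f x` = ((∂^ε_μ G^ε_k ∂^{εᵀ}_ν)f)(x): the left-hand side (∂_μG′_k∂*_νf)(x) of (1.136) for the scalar torus tower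
(U = 1, ∂* = transpose). [cite: Balaban1984PropagatorsI, (1.136) p.39] -/
def E (a msq : ℝ) (k : ℕ) (μ ν : Fin P.d) (f : Site P 0 → ℝ) (x : Site P 0) : ℝ :=
  ((deriv P 0 P.eps μ * (tower P a msq).G k * (deriv P 0 P.eps ν)ᵀ) *ᵥ f) x

/-- `K0 μ ν x x′` = the (x,x′) entry of ∂^ε_μ G^ε_1 ∂^{εᵀ}_ν (G^ε_1 = C^{(0),ε}) = the unit-lattice kernel
«C^{(0)}(η^{−1}x, η^{−1}x′)» of (1.136) (`K0_eq`). [cite: Balaban1984PropagatorsI, (1.136) p.40] -/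
def K0 (a msq : ℝ) (μ ν : Fin P.d) (x x' : Site P 0) : ℝ :=
  (deriv P 0 P.eps μ * (tower P a msq).G 1 * (deriv P 0 P.eps ν)ᵀ) x x'

/-- `K1 j μ x ⟨j,y⟩` = (L^jε)^{−1}·(∂^ε_μ G^ε_j Q^*_j)(x,y) = «(∂^{L^{−j}}_μG′_jQ′*_j)((L^jη)^{−1}x, y)» (`K1_eq`); zero off
level j. [cite: Balaban1984PropagatorsI, (1.136) p.40] -/
def K1 (a msq : ℝ) (j : ℕ) (μ : Fin P.d) (x : Site P 0) (u : (i : ℕ) × Site P i) : ℝ :=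
  (P.spacing j)⁻¹ * atLevel j (fun y => (deriv P 0 P.eps μ * (tower P a msq).G j * (tower P a msq).Qks j) x y) u

/-- `K2 j ⟨j,y⟩ ⟨j,y′⟩` = (L^jε)^{−2}·C^{(j),L^jε}(y,y′) = «C^{(j)}(y, y′)» (the dictionary's (length)² rule for the
inverse (2.30)); zero off level j. [cite: Balaban1984PropagatorsI, (1.136) p.40] -/
def K2 (a msq : ℝ) (j : ℕ) (u u' : (i : ℕ) × Site P i) : ℝ :=
  (P.spacing j ^ 2)⁻¹ * atLevel j (fun y => atLevel j (fun y' => (tower P a msq).C j y y') u') u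

/-- `K3 j ν ⟨j,y′⟩ x′` = (L^jε)^{−1}L^{jd}·(Q_j G^ε_j ∂^{εᵀ}_ν)(y′,x′) = «(Q′_jG′_j∂^{L^{−j}*}_ν)(y′, (L^jη)^{−1}x′)», the kernel
for the weight L^{−jd} written explicitly in (1.136) (`K3_eq`); zero off level j. [cite: Balaban1984PropagatorsI, (1.136) p.40] -/
def K3 (a msq : ℝ) (j : ℕ) (ν : Fin P.d) (u : (i : ℕ) × Site P i) (x' : Site P 0) : ℝ :=
  (P.spacing j)⁻¹ * (P.L : ℝ) ^ (j * P.d) *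
    atLevel j (fun y => ((tower P a msq).Qk j * (tower P a msq).G j * (deriv P 0 P.eps ν)ᵀ) y x') u

/-- THE `ScaleData` OF THE CONCRETE SCALAR TORUS TOWER at B5-level `S.k` (see the module docstring for every field).
[cite: Balaban1984PropagatorsI, (1.135)–(1.136) pp.39–40] -/
def scaleData (A : Aux P S) (a msq : ℝ) : B5Ineq137.ScaleData S where
  X := Site P 0
  TX := Finset.univ
  U := (i : ℕ) × Site P i
  TU := TU P
  Dir := Fin P.d
  F := Site P 0 → ℝ
  eval f x := f x
  holderF := A.holderF
  supF := A.supF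
  comp := A.comp
  E := E P a msq S.k
  cube := A.cube
  distX := A.distX
  dXU := A.dXU
  dUU := A.dUU
  K0 := K0 P a msq
  K1 := K1 P a msq
  K2 := K2 P a msq
  K3 := K3 P a msq
  a := B1.aSeq a P.L

end Instance

/-! ## §4 (1.136) for the concrete tower -/

section Display

variable (P : Params) (S : B5.Setting) (A : Aux P S)

/-- The j-th kernel of (1.136), j ≥ 1, with its weight: L^{−jd}·a_j²Σ_{y,y′}K1·K2·K3 = the (x,x′) entry of
∂^ε_μ(a_j²(L^jε)^{−4}G^ε_jQ^*_jC^{(j),L^jε}Q_jG^ε_j)∂^{εᵀ}_ν — the powers of L^jε of the dictionary recombine to α_j².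
[cite: Balaban1984PropagatorsI, (1.135)–(1.136) pp.39–40] -/
theorem term_entry (a msq : ℝ) {j : ℕ} (hj : 1 ≤ j) (μ ν : Fin P.d) (x x' : Site P 0) :
    ((P.L : ℝ) ^ (j * P.d))⁻¹ * B5Ineq137.kerW (scaleData P S A a msq) j μ ν x x'
      = (deriv P 0 P.eps μ * (tower P a msq).term j * (deriv P 0 P.eps ν)ᵀ) x x' := by
  have hj0 : j ≠ 0 := by omega
  have hs : P.spacing j ≠ 0 := (P.spacing_pos j).ne'
  have hL : (P.L : ℝ) ^ (j * P.d) ≠ 0 := pow_ne_zero _ P.cast_L_pos.ne'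
  rw [B5Ineq137.kerW, if_neg hj0]
  show ((P.L : ℝ) ^ (j * P.d))⁻¹ * (B1.aSeq a P.L j ^ 2 *
      ∑ u ∈ TU P j, ∑ u' ∈ TU P j, K1 P a msq j μ x u * K2 P a msq j u u' * K3 P a msq j ν u' x') = _
  rw [sum_TU]
  simp_rw [sum_TU]
  simp only [K1, K2, K3, atLevel_mk]
  rw [term_eq, Matrix.mul_smul, Matrix.smul_mul, Matrix.smul_apply, smul_eq_mul,
    show deriv P 0 P.eps μ * ((tower P a msq).G j * (tower P a msq).Qks j * (tower P a msq).C j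
        * (tower P a msq).Qk j * (tower P a msq).G j) * (deriv P 0 P.eps ν)ᵀ
      = (deriv P 0 P.eps μ * (tower P a msq).G j * (tower P a msq).Qks j) * (tower P a msq).C j
        * ((tower P a msq).Qk j * (tower P a msq).G j * (deriv P 0 P.eps ν)ᵀ) by simp only [Matrix.mul_assoc],
    triple_apply]
  rw [Finset.mul_sum, Finset.mul_sum, Finset.mul_sum]
  refine Finset.sum_congr rfl fun y _ => ?_
  rw [Finset.mul_sum, Finset.mul_sum, Finset.mul_sum]
  refine Finset.sum_congr rfl fun y' _ => ?_
  field_simp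

/-- The kernel identity behind (1.136): the (x,x′) entry of ∂^ε_μG^ε_k∂^{εᵀ}_ν is Σ_{j=0}^{k−1} L^{−jd}·W_j(x,x′) with the
kernels of `scaleData` — from (2.43) (`B1RG242Torus.display243`). [cite: Balaban1984PropagatorsI, (1.135)–(1.136) pp.39–40] -/
theorem entry_eq {a msq : ℝ} (ha : 0 < a) (hm : 0 ≤ msq) (hk : 1 ≤ S.k) (μ ν : Fin P.d) (x x' : Site P 0) :
    (deriv P 0 P.eps μ * (tower P a msq).G S.k * (deriv P 0 P.eps ν)ᵀ) x x'
      = ∑ j ∈ Finset.range S.k, ((P.L : ℝ) ^ (j * P.d))⁻¹ * B5Ineq137.kerW (scaleData P S A a msq) j μ ν x x' := by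
  obtain ⟨k', hk'⟩ : ∃ k', S.k = k' + 1 := ⟨S.k - 1, by omega⟩
  rw [display243 P ha hm S.k hk, Matrix.mul_add, Matrix.add_mul, Finset.mul_sum, Finset.sum_mul, Matrix.add_apply,
    Matrix.sum_apply, hk', Finset.range_eq_Ico, Finset.sum_eq_sum_Ico_succ_bot (Nat.succ_pos k'), add_comm]
  congr 1
  · rw [B5Ineq137.kerW, if_pos rfl, zero_mul, pow_zero, inv_one, one_mul]
    rfl
  · refine Finset.sum_congr rfl fun j hjm => ?_
    exact (term_entry P S A a msq (Finset.mem_Ico.mp hjm).1 μ ν x x').symm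

/-- **(1.136) FOR BAŁABAN'S SCALAR TORUS TOWER** (U = 1): for every `0 < a`, `0 ≤ m²` and every B5 level `1 ≤ S.k`,
((∂^ε_μG^ε_k∂^{εᵀ}_ν)f)(x) = Σ_{j=0}^{k−1} Σ_{x′} L^{−jd} W_j(x,x′)(f(x′) − f(x)) with W_0 = `K0`, W_j = a_j²Σ_{y,y′}K1·K2·K3 —
the typed identity `B5Ineq137.Display136` holds for `scaleData P S A a msq`; i.e. the hypothesis (1.136) of
`B5Ineq137.ineq137_of_display136` is DISCHARGED for the concrete tower (the estimates (2.35)–(2.37) are not).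
[cite: Balaban1984PropagatorsI, (1.136) pp.39–40; Balaban1982Higgs1, (2.43) p.612] -/
theorem display136_of_tower {a msq : ℝ} (ha : 0 < a) (hm : 0 ≤ msq) (hk : 1 ≤ S.k) :
    B5Ineq137.Display136 (scaleData P S A a msq) P.L P.d := by
  intro μ ν f x _
  show ((deriv P 0 P.eps μ * (tower P a msq).G S.k * (deriv P 0 P.eps ν)ᵀ) *ᵥ f) x
      = ∑ j ∈ Finset.range S.k, ∑ x' : Site P 0,
          ((P.L : ℝ) ^ (j * P.d))⁻¹ * B5Ineq137.kerW (scaleData P S A a msq) j μ ν x x' * (f x' - f x)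
  rw [mulVec_eq_sum_mul_sub _ (mul_deriv_transpose_mulVec_const _ _ _ _) f x, Finset.sum_comm]
  refine Finset.sum_congr rfl fun x' _ => ?_
  rw [← Finset.sum_mul, entry_eq P S A ha hm hk]

/-- **(1.137)'s derivation for the concrete tower has one hypothesis fewer**: `B5Ineq137.ineq137_of_display136` with
its hypothesis (1.136) DISCHARGED by `display136_of_tower` — the located leaf (2.35)–(2.37) (`Leaf235to237`), the
geometry / row-sum / norm facts remain hypotheses exactly as in `B5Ineq137`. [cite: Balaban1984PropagatorsI, (1.136)–(1.137) pp.39–40] -/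
theorem ineq137_of_tower {a msq : ℝ} (ha : 0 < a) (hm : 0 ≤ msq) (hk : 1 ≤ S.k) (c₀ δ₀' cc ā R Λ : ℝ)
    (hc₀ : 0 ≤ c₀) (hδ : 0 < δ₀') (hā : ∀ j, |B1.aSeq a P.L j| ≤ ā)
    (hleaf : B5Ineq137.Leaf235to237 (scaleData P S A a msq) P.L c₀ δ₀')
    (G : B5Ineq137.Geometry (scaleData P S A a msq) P.L cc)
    (Rw : B5Ineq137.RowSums (scaleData P S A a msq) P.L P.d (δ₀' / 4) R Λ)
    (N : B5Ineq137.NormFacts (scaleData P S A a msq)) :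
    B5Ineq137.Ineq137 (scaleData P S A a msq)
      (fun ε => 2 * ((c₀ + ā ^ 2 * c₀ ^ 3 * R ^ 2) * Real.exp (δ₀' / 2 * cc) * Λ) / ((P.L : ℝ) ^ ε - 1)) (δ₀' / 2) :=
  B5Ineq137.ineq137_of_display136 (scaleData P S A a msq) P.L P.d c₀ δ₀' cc ā R Λ (one_lt_cast_L P) hc₀ hδ hā
    (display136_of_tower P S A ha hm hk) hleaf G Rw N

end Display

/-! ## §5 The dictionary lemmas: the kernels ARE the plain entries of the rescaled operators -/

section Dictionary

variable {P : Params}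

/-- **`K1` is the printed kernel**: K1 j μ x ⟨j,y⟩ = (∂^{L^{−j}}_μ G_j^{resc} Q^*_j)(x,y), the plain (x,y) entry of the
level-j operator rescaled to the L^{−j}-lattice (the y-sum over T₁^{(j)} has weight 1), 1 ≤ j.
[cite: Balaban1984PropagatorsI, (1.136) p.40; Balaban1983RegularityDecay, (2.35) p.582] -/
theorem K1_eq {a msq : ℝ} (ha : 0 < a) (hm : 0 ≤ msq) {j : ℕ} (hj : 1 ≤ j) (μ : Fin P.d) (x : Site P 0)
    (y : Site P j) :
    K1 P a msq j μ x ⟨j, y⟩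
      = (deriv P 0 (P.eps / P.spacing j) μ * Grs P a msq j * (tower P a msq).Qks j) x y := by
  have hs : P.spacing j ≠ 0 := (P.spacing_pos j).ne'
  rw [K1, atLevel_mk, deriv_rescale, G_eq_smul_Grs ha hm hj]
  simp only [Matrix.mul_smul, Matrix.smul_mul, Matrix.smul_apply, smul_eq_mul]
  field_simp

/-- **`K3` is the printed kernel**: K3 j ν ⟨j,y′⟩ x′ = L^{jd}·(Q_j G_j^{resc} ∂^{L^{−j}ᵀ}_ν)(y′,x′) — the entry divided by the
weight L^{−jd} of the x′-sum that (1.136) writes explicitly, 1 ≤ j. [cite: Balaban1984PropagatorsI, (1.136) p.40] -/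
theorem K3_eq {a msq : ℝ} (ha : 0 < a) (hm : 0 ≤ msq) {j : ℕ} (hj : 1 ≤ j) (ν : Fin P.d) (y : Site P j)
    (x' : Site P 0) :
    K3 P a msq j ν ⟨j, y⟩ x'
      = (P.L : ℝ) ^ (j * P.d)
          * ((tower P a msq).Qk j * Grs P a msq j * (deriv P 0 (P.eps / P.spacing j) ν)ᵀ) y x' := by
  have hs : P.spacing j ≠ 0 := (P.spacing_pos j).ne'
  rw [K3, atLevel_mk, deriv_rescale, G_eq_smul_Grs ha hm hj]
  simp only [Matrix.transpose_smul, Matrix.mul_smul, Matrix.smul_mul, Matrix.smul_apply, smul_eq_mul]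
  field_simp

/-- **`K0` is the printed kernel**: K0 μ ν x x′ = (∂^1_μ G_0^{unit} ∂^{1ᵀ}_ν)(x,x′), the plain entry on the unit lattice
ε^{−1}T_ε of the j = 0 term rescaled by η = ε. [cite: Balaban1984PropagatorsI, (1.136) p.40] -/
theorem K0_eq {a msq : ℝ} (ha : 0 < a) (hm : 0 ≤ msq) (μ ν : Fin P.d) (x x' : Site P 0) :
    K0 P a msq μ ν x x' = (deriv P 0 1 μ * G0unit P a msq * (deriv P 0 1 ν)ᵀ) x x' := by
  have hε : P.eps ≠ 0 := P.eps_pos.ne'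
  have h1 : ∀ ρ : Fin P.d, deriv P 0 1 ρ = P.eps • deriv P 0 P.eps ρ := fun ρ => by
    rw [← deriv_rescale, div_self hε]
  rw [K0, G_one_eq_smul_G0unit ha hm, h1 μ, h1 ν]
  simp only [Matrix.transpose_smul, Matrix.mul_smul, Matrix.smul_mul, Matrix.smul_apply, smul_eq_mul]
  ring

/-- `K2` on level-j points: K2 j ⟨j,y⟩ ⟨j,y′⟩ = (L^jε)^{−2}·C^{(j),L^jε}(y,y′). [cite: Balaban1984PropagatorsI, (1.136) p.40] -/
theorem K2_mk (a msq : ℝ) (j : ℕ) (y y' : Site P j) :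
    K2 P a msq j ⟨j, y⟩ ⟨j, y'⟩ = (P.spacing j ^ 2)⁻¹ * (tower P a msq).C j y y' := by
  rw [K2, atLevel_mk, atLevel_mk]

/-- `K3` is the transpose-side twin of `K1` up to the block normalisation: for Bałaban's levels 1 ≤ j ≤ m + K,
K3 j ν ⟨j,y⟩ x′ = K1-type entry with Q_j = L^{−jd}(Q^*_j)ᵀ — recorded as the identity
(L^jε)·K3 j ν ⟨j,y⟩ x′ = L^{jd}·(Q_j G^ε_j ∂^{εᵀ}_ν)(y,x′) (definitional bookkeeping, no symmetry of G used). [folklore] -/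
theorem spacing_mul_K3 (a msq : ℝ) (j : ℕ) (ν : Fin P.d) (y : Site P j) (x' : Site P 0) :
    P.spacing j * K3 P a msq j ν ⟨j, y⟩ x'
      = (P.L : ℝ) ^ (j * P.d) * ((tower P a msq).Qk j * (tower P a msq).G j * (deriv P 0 P.eps ν)ᵀ) y x' := by
  have hs : P.spacing j ≠ 0 := (P.spacing_pos j).ne'
  rw [K3, atLevel_mk, ← mul_assoc, ← mul_assoc, mul_inv_cancel₀ hs, one_mul]

end Dictionary

/-! ## §6 The covariance rescaled to the unit lattice (B1 (2.31)): `K2` is its plain entry -/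

section CRescaling

variable (P : Params)

/-- Δ^{(j)} RESCALED TO THE UNIT LATTICE T₁^{(j)}: a_j·1 − a_j²·Q_j G_j^{resc} Q^*_j — (2.21) «⟨ψ,Δ^{(k),L^kε}ψ⟩ =
a_k(L^kε)^{−2}⟨ψ,ψ⟩ − a_k²(L^kε)^{−4}⟨ψ,Q_kG^ε_kQ^*_kψ⟩» with the powers of L^kε removed by the dictionary (G^ε_j =
(L^jε)²·G_j^{resc}, `G_eq_smul_Grs`); U = 1, whole torus. [cite: Balaban1982Higgs1, (2.21) p.610, (2.31) p.611] -/
def Drs (a msq : ℝ) (j : ℕ) : Matrix (Site P j) (Site P j) ℝ :=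
  B1.aSeq a P.L j • (1 : Matrix (Site P j) (Site P j) ℝ)
    - B1.aSeq a P.L j ^ 2 • (Qk P j * Grs P a msq j * Qks P j)

/-- **C^{(j)} = (aL^{−2}P + Δ^{(j)})^{−1}**, P = Q^*Q the one-step block projection on T^{(j)}: «In the sequel we will use
the covariance rescaled to the unit lattice and it is of the form C^{(k)}(Ω, A) = (aL^{−2}P(A) + Δ^{(k)}(Ω, A))^{−1}.
(2.31)» — U = 1, Ω = the whole torus. [cite: Balaban1982Higgs1, (2.31) p.611] -/
def Crs (a msq : ℝ) (j : ℕ) : Matrix (Site P j) (Site P j) ℝ :=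
  ((a * ((P.L : ℝ) ^ 2)⁻¹) • (Qs P j * Q P j) + Drs P a msq j)⁻¹

variable {P}

/-- The tower's C^{(j),L^jε} (2.30) written over the torus `Site P j` with its own instances (the tower carries the
same instances as structure fields; definitional). [cite: Balaban1982Higgs1, (2.30) p.611] -/
theorem C_def_site (a msq : ℝ) (j : ℕ) :
    (tower P a msq).C j
      = (β P a j • (Qs P j * Q P j) + (α P a j • (1 : Matrix (Site P j) (Site P j) ℝ)
          - α P a j ^ 2 • (Qk P j * (tower P a msq).G j * Qks P j)))⁻¹ := rfl

/-- (c·B)^{−1} = c^{−1}·B^{−1} for a nonzero scalar and a genuinely invertible matrix. [folklore] -/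
theorem smul_inv_of_isUnit_det {ι : Type} [Fintype ι] [DecidableEq ι] {c : ℝ} (hc : c ≠ 0) {B : Matrix ι ι ℝ}
    (hB : IsUnit B.det) : (c • B)⁻¹ = c⁻¹ • B⁻¹ :=
  Matrix.inv_eq_left_inv (by
    rw [Matrix.smul_mul, Matrix.mul_smul, smul_smul, inv_mul_cancel₀ hc, one_smul, Matrix.nonsing_inv_mul _ hB])

/-- The argument of C^{(j),L^jε} ((2.30) on the L^jε-lattice: a(L^{j+1}ε)^{−2}P + Δ^{(j),L^jε}, (2.21) inserted) is
(L^jε)^{−2} times the argument of the unit-lattice covariance (2.31), for Bałaban's levels 1 ≤ j.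
[cite: Balaban1982Higgs1, (2.21) p.610, (2.30)–(2.31) p.611] -/
theorem C_arg_rescale {a msq : ℝ} (ha : 0 < a) (hm : 0 ≤ msq) {j : ℕ} (hj : 1 ≤ j) :
    β P a j • (Qs P j * Q P j) + (α P a j • (1 : Matrix (Site P j) (Site P j) ℝ)
        - α P a j ^ 2 • (Qk P j * (tower P a msq).G j * Qks P j))
      = (P.spacing j ^ 2)⁻¹ • ((a * ((P.L : ℝ) ^ 2)⁻¹) • (Qs P j * Q P j) + Drs P a msq j) := by
  have hs : P.spacing j ≠ 0 := (P.spacing_pos j).ne'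
  have hL : (P.L : ℝ) ≠ 0 := P.cast_L_pos.ne'
  rw [G_eq_smul_Grs ha hm hj, β, α, P.spacing_succ, Drs]
  ext y y'
  simp only [Matrix.add_apply, Matrix.sub_apply, Matrix.smul_apply, Matrix.mul_smul, Matrix.smul_mul, smul_eq_mul]
  field_simp

/-- **C^{(j),L^jε} = (L^jε)²·C^{(j)}** for Bałaban's levels 1 ≤ j: the tower's covariance (2.30) is (L^jε)² times the
(2.31) «covariance rescaled to the unit lattice» — PROVED (the dictionary's (length)² rule for the inverse (2.30),
from `consistent.C_arg` and `G_eq_smul_Grs`). [cite: Balaban1982Higgs1, (2.30)–(2.31) p.611] -/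
theorem C_eq_smul_Crs {a msq : ℝ} (ha : 0 < a) (hm : 0 ≤ msq) {j : ℕ} (hj : 1 ≤ j) :
    (tower P a msq).C j = P.spacing j ^ 2 • Crs P a msq j := by
  have hs2 : P.spacing j ^ 2 ≠ 0 := pow_ne_zero 2 (P.spacing_pos j).ne'
  have hA : IsUnit (β P a j • (Qs P j * Q P j) + (α P a j • (1 : Matrix (Site P j) (Site P j) ℝ)
      - α P a j ^ 2 • (Qk P j * (tower P a msq).G j * Qks P j))) := (consistent P ha hm).C_arg j hj
  rw [C_arg_rescale ha hm hj] at hA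
  have hdet := ((Matrix.isUnit_iff_isUnit_det _).mp hA).ne_zero
  rw [Matrix.det_smul] at hdet
  have hB : IsUnit ((a * ((P.L : ℝ) ^ 2)⁻¹) • (Qs P j * Q P j) + Drs P a msq j).det :=
    isUnit_iff_ne_zero.mpr (right_ne_zero_of_mul hdet)
  rw [C_def_site, C_arg_rescale ha hm hj, smul_inv_of_isUnit_det (inv_ne_zero hs2) hB, inv_inv, Crs]

/-- **`K2` is the printed kernel**: K2 j ⟨j,y⟩ ⟨j,y′⟩ = C^{(j)}(y,y′), the plain entry of the (2.31) covariance on the unit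
lattice T₁^{(j)} (both sums over T₁^{(j)} in (1.136) have weight 1), 1 ≤ j. [cite: Balaban1984PropagatorsI, (1.136) p.40;
Balaban1982Higgs1, (2.31) p.611] -/
theorem K2_eq {a msq : ℝ} (ha : 0 < a) (hm : 0 ≤ msq) {j : ℕ} (hj : 1 ≤ j) (y y' : Site P j) :
    K2 P a msq j ⟨j, y⟩ ⟨j, y'⟩ = Crs P a msq j y y' := by
  have hs2 : P.spacing j ^ 2 ≠ 0 := pow_ne_zero 2 (P.spacing_pos j).ne'
  rw [K2_mk, C_eq_smul_Crs ha hm hj, Matrix.smul_apply, smul_eq_mul, ← mul_assoc, inv_mul_cancel₀ hs2, one_mul]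

end CRescaling

end B5Display136Torus

end

end Literature.MathematicalPhysics.QuantumFieldTheory.Balaban1983to89
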